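import Literature.Barriers.BirchSwinnertonDyer.RankNotSumOfLocalInvariantsProofs
import Mathlib.Data.Rat.Sqrt
import Mathlib.Tactic.NormNum.IsSquare
import HarnessLib

/-!
# The curve `480a1`: a rational point of infinite order

Support for the rank leaves of Theorem 2 of T. Dokchitser–V. Dokchitser, *A note on the
Mordell–Weil rank modulo `n`*, J. Number Theory 131 (2011) 1833–1839 (arXiv:0910.4588), whose
proof uses `E = 480a1 : y² = x(x+2)(x-3)` (tree `Literature.Barriers.BirchSwinnertonDyer.curve480a1`,
model `[0, -1, 0, -6, 0]`, i.e. `y² = x³ - x² - 6x`). The printed ranks `rk E/F₃ = rk E/F₅ = 1`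
are obtained "using Magma, over all minimal non-trivial subfields of `F_n`" (proof of Thm. 2);
passing from the minimal subfields to `F_n` needs, besides representation theory, a point of
infinite order in `E(ℚ)`. This file PROVES that one exists, by an elementary `2`-power-torsion
argument on the explicit model (no Lutz–Nagell, no Mazur, no reduction theory — none is in Mathlib):

* `curve480a1.some_add_some_self`: for `S ∈ E(ℚ)`, either `2S = 0` or `x(2S) = t²` with
  `t = (x² + 6) / 2y ≠ 0` (duplication formula on `y² = x³ - x² - 6x`);
* `curve480a1.some_add_self_eq_zero_iff`, `curve480a1.x_of_nonsingular_zero`: the points killed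
  by `2` are `0` and `(0,0), (3,0), (-2,0)`;
* `curve480a1.add_self_eq_zero_of_four`: no rational point of order `4` (`x(2S)` would be a
  non-zero square equal to `0`, `3` or `-2`);
* `curve480a1.not_isOfFinAddOrder_basePoint`: `P₀ = (-1, 2)` has infinite order — if `n P₀ = 0`,
  `n = 2ᵏ b` with `b` odd, then `Q = b P₀` is killed by `2`, and `P₀ + Q = 2 · ((b+1)/2) P₀` has
  `x`-coordinate `-1, 6, -3/4, 8` according as `Q = 0, (0,0), (3,0), (-2,0)`, none a square.

Everything is stated for the base change `curve480a1.baseChange F` to a `ℚ`-algebra `F` (a field)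
where that costs nothing (`curve480a1.nonsingular_iff`), and over `ℚ` otherwise; points are
Mathlib's `WeierstrassCurve.Affine.Point` with its group law.

## References

* T. Dokchitser, V. Dokchitser, *A note on the Mordell–Weil rank modulo `n`*, J. Number Theory
  131 (2011) 1833–1839, arXiv:0910.4588: proof of Thm. 2 (the curve `480a1`).
  [DokchitserDokchitser2011RankModN]
* J. H. Silverman, *The Arithmetic of Elliptic Curves*, GTM 106 (2nd ed., 2009): III.2.3
  (group law, duplication formula). [SilvermanAEC2009]
-/

noncomputable section

open WeierstrassCurve WeierstrassCurve.Affine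

namespace Literature.Barriers.BirchSwinnertonDyer

/-- `480a1` over a `ℚ`-algebra `F`, as an affine Weierstrass curve (local notation). -/
local notation "𝔼⟮" F "⟯" => WeierstrassCurve.Affine.baseChange curve480a1 F

section Coefficients

variable (F : Type) [Field F] [Algebra ℚ F]

/-- `a₁ = 0` for `480a1` over any `F`. [folklore] -/
theorem curve480a1.baseChange_a₁ : (𝔼⟮F⟯).a₁ = 0 := by
  simp [curve480a1]

/-- `a₂ = -1` for `480a1` over any `F`. [folklore] -/
theorem curve480a1.baseChange_a₂ : (𝔼⟮F⟯).a₂ = -1 := by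
  simp [curve480a1]

/-- `a₃ = 0` for `480a1` over any `F`. [folklore] -/
theorem curve480a1.baseChange_a₃ : (𝔼⟮F⟯).a₃ = 0 := by
  simp [curve480a1]

/-- `a₄ = -6` for `480a1` over any `F`. [folklore] -/
theorem curve480a1.baseChange_a₄ : (𝔼⟮F⟯).a₄ = -6 := by
  simp [curve480a1]

/-- `a₆ = 0` for `480a1` over any `F`. [folklore] -/
theorem curve480a1.baseChange_a₆ : (𝔼⟮F⟯).a₆ = 0 := by
  simp [curve480a1]

/-- `480a1` stays elliptic after base change to a field `F ⊇ ℚ` (Mathlib's instance for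
`WeierstrassCurve.map`, transported along `baseChange = map (algebraMap ℚ F)`). [folklore] -/
theorem curve480a1.isElliptic_baseChange : (𝔼⟮F⟯).IsElliptic :=
  inferInstanceAs (curve480a1.map (algebraMap ℚ F)).IsElliptic

/-- The affine equation of `480a1` over `F`: `y² = x³ - x² - 6x` (`= x(x+2)(x-3)`).
[cite: DokchitserDokchitser2011RankModN, proof of Thm. 2] -/
theorem curve480a1.equation_iff (x y : F) :
    (𝔼⟮F⟯).Equation x y ↔ y ^ 2 = x ^ 3 - x ^ 2 - 6 * x := by
  rw [WeierstrassCurve.Affine.equation_iff, curve480a1.baseChange_a₁, curve480a1.baseChange_a₂,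
    curve480a1.baseChange_a₃, curve480a1.baseChange_a₄, curve480a1.baseChange_a₆]
  constructor <;> intro h <;> linear_combination h

/-- Over a field `F ⊇ ℚ` every solution of `y² = x³ - x² - 6x` is a nonsingular point of `480a1`
(the curve is elliptic, Mathlib `equation_iff_nonsingular`). [folklore] -/
theorem curve480a1.nonsingular_iff (x y : F) :
    (𝔼⟮F⟯).Nonsingular x y ↔ y ^ 2 = x ^ 3 - x ^ 2 - 6 * x := by
  haveI := curve480a1.isElliptic_baseChange F
  rw [← equation_iff_nonsingular, curve480a1.equation_iff]

/-- Negation on `480a1` is `(x, y) ↦ (x, -y)` (`a₁ = a₃ = 0`). [folklore] -/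
theorem curve480a1.negY_eq (x y : F) : (𝔼⟮F⟯).negY x y = -y := by
  rw [WeierstrassCurve.Affine.negY, curve480a1.baseChange_a₁, curve480a1.baseChange_a₃]
  ring

end Coefficients

section OverQ

open WeierstrassCurve.Affine.Point

/-- **Duplication on `480a1`.** For a rational point `S`, either `2S = 0` or
`x(2S) = ((x² + 6) / 2y)²` with `(x² + 6)/2y ≠ 0`: the duplication formula
`x(2S) = λ² + 1 - 2x`, `λ = (3x² - 2x - 6)/2y`, rewritten with `y² = x³ - x² - 6x`.
[cite: SilvermanAEC2009, III.2.3] -/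
theorem curve480a1.some_add_some_self (S : (𝔼⟮ℚ⟯).Point) :
    S + S = 0 ∨ ∃ (t y : ℚ) (h : (𝔼⟮ℚ⟯).Nonsingular (t ^ 2) y), t ≠ 0 ∧ S + S = .some _ _ h := by
  rcases S with _ | ⟨x, y, h⟩
  · exact Or.inl rfl
  · have hy' : (𝔼⟮ℚ⟯).negY x y = -y := curve480a1.negY_eq ℚ x y
    have heq : y ^ 2 = x ^ 3 - x ^ 2 - 6 * x := (curve480a1.nonsingular_iff ℚ x y).mp h
    by_cases hy : y = (𝔼⟮ℚ⟯).negY x y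
    · exact Or.inl (add_self_of_Y_eq hy)
    · right
      have hy0 : y ≠ 0 := by
        intro h0
        apply hy
        rw [hy', h0]
        norm_num
      set L := (𝔼⟮ℚ⟯).slope x x y y with hLdef
      have hL : 2 * y * L = 3 * x ^ 2 - 2 * x - 6 := by
        rw [hLdef, slope_of_Y_ne rfl hy, hy', curve480a1.baseChange_a₁,
          curve480a1.baseChange_a₂, curve480a1.baseChange_a₄]
        field_simp
        ring
      set t := (x ^ 2 + 6) / (2 * y) with htdef
      have ht : 2 * y * t = x ^ 2 + 6 := by
        rw [htdef]
        field_simp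
      have hX : (𝔼⟮ℚ⟯).addX x x L = t ^ 2 := by
        simp only [WeierstrassCurve.Affine.addX, curve480a1.baseChange_a₁,
          curve480a1.baseChange_a₂]
        have h4 : (2 * y) ^ 2 ≠ 0 := by positivity
        apply mul_left_cancel₀ h4
        linear_combination (2 * y * L + (3 * x ^ 2 - 2 * x - 6)) * hL
          - (2 * y * t + (x ^ 2 + 6)) * ht + 4 * (1 - 2 * x) * heq
      have ht0 : t ≠ 0 := by
        intro ht0
        rw [ht0, mul_zero] at ht
        nlinarith [sq_nonneg x]
      refine ⟨t, _, hX ▸ nonsingular_add h h fun hxy => hy hxy.2, ht0, ?_⟩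
      rw [add_self_of_Y_ne hy]
      congr 1

/-- **Points killed by `2`.** An affine rational point `(x, y)` of `480a1` satisfies
`2 (x, y) = 0` iff `y = 0`. [folklore] -/
theorem curve480a1.some_add_self_eq_zero_iff {x y : ℚ} {h : (𝔼⟮ℚ⟯).Nonsingular x y} :
    (.some x y h : (𝔼⟮ℚ⟯).Point) + .some x y h = 0 ↔ y = 0 := by
  have hy' : (𝔼⟮ℚ⟯).negY x y = -y := curve480a1.negY_eq ℚ x y
  by_cases hy : y = (𝔼⟮ℚ⟯).negY x y
  · rw [add_self_of_Y_eq hy]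
    rw [hy'] at hy
    exact iff_of_true rfl (by linarith)
  · rw [add_self_of_Y_ne hy]
    rw [hy'] at hy
    exact iff_of_false (some_ne_zero _) fun h0 => hy (by rw [h0]; norm_num)

/-- The `2`-torsion abscissae of `480a1`: `y = 0` forces `x ∈ {0, 3, -2}` (`x³ - x² - 6x =
x(x-3)(x+2)`). [cite: DokchitserDokchitser2011RankModN, proof of Thm. 2] -/
theorem curve480a1.x_of_nonsingular_zero {x : ℚ} (h : (𝔼⟮ℚ⟯).Nonsingular x 0) :
    x = 0 ∨ x = 3 ∨ x = -2 := by
  have h' := (curve480a1.nonsingular_iff ℚ x 0).mp h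
  have : x * ((x - 3) * (x + 2)) = 0 := by linear_combination -h'
  rcases mul_eq_zero.mp this with h0 | h0
  · exact Or.inl h0
  · rcases mul_eq_zero.mp h0 with h1 | h1
    · exact Or.inr (Or.inl (by linarith))
    · exact Or.inr (Or.inr (by linarith))

/-- **`480a1(ℚ)` has no point of order `4`**: `R + R + (R + R) = 0` forces `R + R = 0`, since
otherwise `x(2R)` is a non-zero rational square equal to `0`, `3` or `-2`. [folklore] -/
theorem curve480a1.add_self_eq_zero_of_four (R : (𝔼⟮ℚ⟯).Point) (h4 : (R + R) + (R + R) = 0) :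
    R + R = 0 := by
  rcases curve480a1.some_add_some_self R with h | ⟨t, y, h, ht, hR⟩
  · exact h
  · exfalso
    rw [hR] at h4
    have hy : y = 0 := curve480a1.some_add_self_eq_zero_iff.mp h4
    subst hy
    rcases curve480a1.x_of_nonsingular_zero h with h0 | h3 | h2
    · exact ht (pow_eq_zero_iff two_ne_zero |>.mp h0)
    · have hsq : IsSquare (3 : ℚ) := ⟨t, by rw [← h3]; ring⟩
      exact absurd hsq (by norm_num)
    · nlinarith [sq_nonneg t]

/-- The `2`-primary torsion of `480a1(ℚ)` is killed by `2`: `2ᵏ⁺¹ R = 0 ⟹ 2 R = 0`.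
[folklore] -/
theorem curve480a1.two_nsmul_eq_zero_of_two_pow_nsmul (k : ℕ) :
    ∀ R : (𝔼⟮ℚ⟯).Point, 2 ^ (k + 1) • R = 0 → 2 • R = 0 := by
  induction k with
  | zero => intro R h; simpa using h
  | succ k ih =>
    intro R h
    rw [pow_succ, mul_nsmul'] at h
    have h2 := ih (2 • R) h
    rw [two_nsmul, two_nsmul] at h2
    rw [two_nsmul]
    exact curve480a1.add_self_eq_zero_of_four R h2

/-- **The rational point `P₀ = (-1, 2)` of `480a1`** (`2² = -1 - 1 + 6`). [folklore] -/
def curve480a1.basePoint : (𝔼⟮ℚ⟯).Point :=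
  .some (-1) 2 ((curve480a1.nonsingular_iff ℚ _ _).mpr (by norm_num))

/-- **`P₀ = (-1, 2)` has infinite order in `480a1(ℚ)`** (so `E(ℚ) ⊗ ℚ ≠ 0`). If `n P₀ = 0`
with `n = 2ᵏ b`, `b` odd, then `Q := b P₀` is killed by `2`
(`curve480a1.two_nsmul_eq_zero_of_two_pow_nsmul`), so `Q ∈ {0, (0,0), (3,0), (-2,0)}`, and
`P₀ + Q = 2 · ((b+1)/2) P₀` is `0` or has square `x`-coordinate
(`curve480a1.some_add_some_self`); but `x(P₀ + Q) = -1, 6, -3/4, 8` respectively, none of which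
is a rational square. [folklore] -/
theorem curve480a1.not_isOfFinAddOrder_basePoint : ¬ IsOfFinAddOrder curve480a1.basePoint := by
  rw [isOfFinAddOrder_iff_nsmul_eq_zero]
  rintro ⟨n, hn, hP⟩
  obtain ⟨k, b, ⟨c, rfl⟩, rfl⟩ := Nat.exists_eq_two_pow_mul_odd hn.ne'
  -- `Q := b • P₀` is killed by `2`
  have h2 : 2 • ((2 * c + 1) • curve480a1.basePoint) = 0 := by
    cases k with
    | zero =>
      rw [pow_zero, one_mul] at hP
      rw [hP, nsmul_zero]
    | succ k =>
      refine curve480a1.two_nsmul_eq_zero_of_two_pow_nsmul k _ ?_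
      rwa [← mul_nsmul']
  -- `P₀ + Q = S + S` with `S := (c + 1) • P₀`
  have hsum : curve480a1.basePoint + (2 * c + 1) • curve480a1.basePoint =
      (c + 1) • curve480a1.basePoint + (c + 1) • curve480a1.basePoint := by
    rw [← add_nsmul, ← succ_nsmul']
    congr 1
    ring
  generalize hQ : (2 * c + 1) • curve480a1.basePoint = Q at h2 hsum
  generalize (c + 1) • curve480a1.basePoint = S at hsum
  have hP0 : curve480a1.basePoint =
      .some (-1) 2 ((curve480a1.nonsingular_iff ℚ _ _).mpr (by norm_num)) :=
    rfl
  -- the `x`-coordinate of `S + S` is a non-zero square, unless `S + S = 0`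
  have key : ∀ {x' y' : ℚ} {h' : (𝔼⟮ℚ⟯).Nonsingular x' y'},
      (.some x' y' h' : (𝔼⟮ℚ⟯).Point) = S + S → ∃ t : ℚ, t ≠ 0 ∧ x' = t ^ 2 := by
    intro x' y' h' he
    rcases curve480a1.some_add_some_self S with h0 | ⟨t, y, h, ht, hS⟩
    · rw [h0] at he
      exact absurd he (some_ne_zero _)
    · rw [hS] at he
      exact ⟨t, ht, (some.inj he).1⟩
  rcases Q with _ | ⟨x, y, h⟩
  · -- `Q = 0`: `x(P₀) = -1`
    rw [← WeierstrassCurve.Affine.Point.zero_def, add_zero, hP0] at hsum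
    obtain ⟨t, -, ht⟩ := key hsum
    nlinarith [sq_nonneg t]
  · rw [two_nsmul] at h2
    have hy : y = 0 := curve480a1.some_add_self_eq_zero_iff.mp h2
    subst hy
    rcases curve480a1.x_of_nonsingular_zero h with rfl | rfl | rfl
    · -- `Q = (0, 0)`: `x(P₀ + Q) = 6`
      rw [hP0, add_of_X_ne (show (-1 : ℚ) ≠ 0 by norm_num)] at hsum
      obtain ⟨t, -, ht⟩ := key hsum
      simp only [WeierstrassCurve.Affine.addX, slope_of_X_ne (show (-1 : ℚ) ≠ 0 by norm_num),
        curve480a1.baseChange_a₁, curve480a1.baseChange_a₂] at ht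
      norm_num at ht
      have hsq : IsSquare (6 : ℚ) := ⟨t, by rw [ht]; ring⟩
      exact absurd hsq (by norm_num)
    · -- `Q = (3, 0)`: `x(P₀ + Q) = -3/4`
      rw [hP0, add_of_X_ne (show (-1 : ℚ) ≠ 3 by norm_num)] at hsum
      obtain ⟨t, -, ht⟩ := key hsum
      simp only [WeierstrassCurve.Affine.addX, slope_of_X_ne (show (-1 : ℚ) ≠ 3 by norm_num),
        curve480a1.baseChange_a₁, curve480a1.baseChange_a₂] at ht
      norm_num at ht
      nlinarith [sq_nonneg t]
    · -- `Q = (-2, 0)`: `x(P₀ + Q) = 8`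
      rw [hP0, add_of_X_ne (show (-1 : ℚ) ≠ -2 by norm_num)] at hsum
      obtain ⟨t, -, ht⟩ := key hsum
      simp only [WeierstrassCurve.Affine.addX, slope_of_X_ne (show (-1 : ℚ) ≠ -2 by norm_num),
        curve480a1.baseChange_a₁, curve480a1.baseChange_a₂] at ht
      norm_num at ht
      have hsq : IsSquare (8 : ℚ) := ⟨t, by rw [ht]; ring⟩
      exact absurd hsq (by norm_num)

end OverQ

end Literature.Barriers.BirchSwinnertonDyer

end
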